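import Mathlib
import Literature.MathematicalPhysics.QuantumFieldTheory.Dimock2011to13.QED3BlockingGeometry
import HarnessLib

/-!
# Dimock, *Ultraviolet stability for QED in d = 3*, Appendix D «more bounds»: LEMMA 29 (543) — the plaquette
# block-averaging operator `Q^{(2)}_k` is `L²`-bounded with a one-layer enlargement, `‖Q^{(2)}_k F‖_X ≤ O(1)‖F‖_{X̃}` —
# with its printed proof (544)–(547), its use (548)–(549), and LEMMA 30 (550)–(551) (the multiscale sum) — PROVED,
# `O(1) = 1` per plaquette orientation

statement-level skeleton of published theorems with citation tags; proofs where landed; nothing here is a claim about the Yang–Mills mass gap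

**Citation header (reproduction of PUBLISHED work).** J. Dimock, *Ultraviolet stability for QED in d = 3*,
Ann. Henri Poincaré **23** (2022) 2113–2205 (= arXiv:2009.01156v2) [Dimock2022UVStabilityQED3], **Appendix D**, p.75 L68 –
p.76 L51 of the held arXiv-v2 text layer `paper:arxiv-2009.01156` (`p.NN Lnn` = PDF page ∕ text-layer line); the formula
for `Q^{(2)}` is (544) there and (474) p.64 L81–88.  Writer seat p11 (literature-prover-lit-balaban-p11-g23-0), YM LIT
SWEEP item (c) D8 (row C08; zero weight for the YM-INPRINT tokens — the paper is `d = 3` QED).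

**The printed text.** p.75 L68–75: *"D more bounds. We give a bound relating `A_{k,Ω}` and the fundamental fields `A_j`.
First a preliminary estimate. **Lemma 29.** Let `X` be a union of unit blocks in `T^{−k}_{N−k}` with `X̃` an enlargement
by a layer of unit cubes. For a function `F` on plaquettes in `T^{−k}_{N−k}` the `L²` norms satisfy
`‖Q^{(2)}_k F‖_X ≤ O(1)‖F‖_{X̃}` (543)."*  Proof, p.75 L76 – p.76 L22: *"For `x ∈ T^{−k}_{N−k}` let
`P_x = [x, x + e_μ, x + e_μ + e_ν, x + e_ν]`. Then for `y ∈ T⁰_{N−k}` we have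
`(Q^{(2)}_k F)(P_y) = ∫_{|x−y|≤½} L^{−2k} Σ_{p∈P_x} F(p) = ∫_{|x−y|≤½} ∫_{p∈P_x} F(p)` (544). By the Schwarz inequality in the
`p` integral `|∫_{p∈P_x} F(p)|² ≤ ∫_{p∈P_x} |F(p)|²` (545) and then by the Schwarz inequality in the `x` integral
`|(Q^{(2)}_k F)(P_y)|² ≤ ∫_{|x−y|≤½} ∫_{p∈P_x} |F(p)|²` (546). Then
`‖Q^{(2)}_k F‖²_X ≡ Σ_{y : P_y ∩ X ≠ ∅} |(Q^{(2)}_k F)(P_y)|² ≤ ∫_{x∈X̃} ∫_{p∈P_x} |F(p)|² = ∫_{p∈X̃} ∫_{x∈X̃ : P_x ∋ p} |F(p)|²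
≤ O(1)‖F‖²_{X̃}` (547). This completes the proof."*  p.76 L23–32: *"Now consider `A_{k,Ω}` which satisfies
`Q_{k,Ω}A_{k,Ω} = A_{k,Ω}`. Then `dA_{k,Ω} = dQ_{k,Ω}A_{k,Ω} = Q^{(2)}_{k,Ω} dA_{k,Ω}` (548). In `Ω_k` this says
`dA_k = Q^{(2)}_k dA_{k,Ω}`. It follows by lemma 29 that `‖dA_k‖²_X ≤ O(1)‖dA_{k,Ω}‖²_{X̃}`, `X̃ ⊂ Ω_k` (549). We want to drop
the restriction to `Ω_k` here. **Lemma 30.** Let `X = ∪X_j` where `X_j ⊂ δΩ_j` is a union of `L^{−(k−j)}` cubes whose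
enlargements at that scale also satisfy `X̃_j ⊂ δΩ_j`. Then `Σ_{j=0}^{k} ‖dA_j‖²_{X_j} ≤ O(1)‖dA_{k,Ω}‖²` (550). Proof. `A_j` is
a function on `δΩ^{(j)}_j ⊂ T^{−(k−j)}_{N−k}`. Therefore `A_{j,L^{k−j}}` is a function on a subset of the unit lattice
`T⁰_{N−j}` and on `L^kδΩ_j` we have `Q^{(2)}_j dA_{k,Ω,L^{k−j}} = dA_{j,L^{k−j}}`. Then by a bound like (549)
`‖dA_j‖²_{X_j} = ‖dA_{j,L^{k−j}}‖²_{L^{k−j}X_j} ≤ O(1)‖dA_{k,Ω,L^{k−j}}‖²_{(L^{k−j}X_j)^∼} = O(1)‖dA_{k,Ω}‖²_{X̃_j}` (551).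
Summing over `j` gives the result."*  (474) p.64 L81–89: *"`(Q^{(2)}_j Q^{e,T}_k dA_k)(p) = L^{−5j} Σ_{x∈B_j(y)} Σ_{p′∈p_x}
(Q^{e,T}_k dA_k)(p′)` where `p_x` is `p` translated so a fixed corner is `x`"* (`L^{−5j} = L^{−3j}·L^{−2j}`, `d = 3`).

**What is formalized (all PROVED; no named facts, no `sorry`).**  FINE INDEX COORDINATES: the fine lattice
`T^{−k}_{N−k}` is `ℤ^ι` (`ι` a `Fintype` of directions, the paper has `ι = Fin 3`), the unit lattice `T⁰_{N−k}` is
`n·ℤ^ι` with `n = L^k = 2a + 1` odd (`side a`), a unit point being recorded by its index `y : ι → ℤ`; the unit cube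
`|x − y| ≤ ½` is gen 22's centred cube `QED3TorusII.cube a (n•y)` of `QED3BlockingGeometry.lean` (paper I (21): `L` odd,
the cubes partition the lattice — `QED3TorusII.mem_cube_smul_iff`), and a union of unit blocks `X` is
`QED3TorusII.blockUp a S`, `S` its set of centres.  A plaquette function is handled ONE ORIENTATION `(μ, ν)` AT A TIME
(the operator (544) does not mix orientations): `F : (ι → ℤ) → E` is the value on the fine plaquette with lower corner
`z` in the `(μ, ν)` plane, with values in any real normed space `E`.
* `tile n μ ν x` — the lower corners `x + s e_μ + t e_ν`, `0 ≤ s, t < n`, of the `n²` fine plaquettes `p ∈ P_x`;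
  `card_tile_le` (`≤ n²`), `card_tile_eq` (`= n²` for `μ ≠ ν`), `card_filter_mem_tile_le` (**`#{x : P_x ∋ p} ≤ n²`**, the
  count behind the last `O(1)` of (547)); `card_cube` (`#B(y) = n^{|ι|}`).
* `plaqAvg a μ ν F y` — **(544)**: `(Q^{(2)} F)(P_y) = (n^{|ι|}·n²)^{−1} Σ_{x ∈ B(y)} Σ_{p ∈ P_x} F(p)` (= (474) with
  `L^{−5j}` ↦ `n^{−|ι|−2}`); `plaqAvg_const` (`Q^{(2)}c = c` for `μ ≠ ν`: it IS an average).
* `eq545` — **(545)** (`‖Σ_{p∈P_x}F‖² ≤ n²Σ_{p∈P_x}‖F‖²`); `norm_sq_plaqAvg_le` — **(545)–(546)**: `‖(Q^{(2)}F)(P_y)‖² ≤ (n^{|ι|}n²)^{−1} Σ_{x∈B(y)} Σ_{p∈P_x} ‖F(p)‖²` (Schwarz).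
* `sum_sum_tile_le` — the exchange `Σ_x Σ_{p∈P_x} = Σ_p #{x : P_x ∋ p}` of (547) with the count `≤ n²`.
* `reach a μ ν Y` — the fine plaquettes entering `(Q^{(2)}F)(P_y)`, `y ∈ Y`; **`lemma29_sharp`**: for EVERY finite set
  `Y` of unit plaquettes, `n^{|ι|} Σ_{y∈Y} ‖(Q^{(2)}F)(P_y)‖² ≤ Σ_{p ∈ reach Y} ‖F(p)‖²` — this is (547) with `O(1) = 1`;
  `lemma29_sharp_sum` (the same summed over any finite family of orientations, termwise).
* `corners μ ν y`, `Meets μ ν S y` — *"`P_y ∩ X ≠ ∅`"* for `X` the union of the CLOSED unit cubes centred on `S`: one of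
  the four corners `y, y+e_μ, y+e_ν, y+e_μ+e_ν` of `P_y` is a centre in `S` (a closed unit square meets a closed unit
  cube of the cubic tiling iff the cube's centre is a corner of the square); `reach_subset_enlarge` (for `μ ≠ ν`): the
  fine plaquettes reached from such `y` lie in `X̃ = blockUp a (enlarge S)`, `enlarge S = ⋃_{s∈S} cube 1 s` (*"an
  enlargement by a layer of unit cubes"*); **`lemma29`** — (543) AS PRINTED:
  `n^{|ι|} Σ_{y : P_y ∩ X ≠ ∅} ‖(Q^{(2)}F)(P_y)‖² ≤ Σ_{p ∈ X̃} ‖F(p)‖²`.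
* `eq549` — (548) ⟹ (549): any unit-plaquette function `G` that agrees with `Q^{(2)}F` on `Y` obeys the same bound.
* **`lemma30`** — (550): for a finite family of scales `j` (side `n_j = 2a_j + 1`, orientation `(μ_j, ν_j)`, unit-plaquette
  sets `Y_j`, fields `G_j = Q^{(2)}_{n_j}F` on `Y_j` — the identity *"`Q^{(2)}_j dA_{k,Ω,L^{k−j}} = dA_{j,L^{k−j}}` on
  `L^kδΩ_j`"* of the proof) whose reaches are pairwise disjoint and contained in `R` (*"`X̃_j ⊂ δΩ_j`"*, the `δΩ_j` being
  disjoint): `Σ_j n_j^{|ι|} Σ_{y∈Y_j} ‖G_j(y)‖² ≤ Σ_{p∈R} ‖F(p)‖²`.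

**Normalization (reading, declared).** Dimock's integrals carry the lattice volume: on `T^{−k}`, `∫_x = L^{−3k}Σ_x` and
`∫_{p∈P_x} = L^{−2k}Σ_{p∈P_x}` ((544)), and `‖F‖²_{X̃} = ∫_{p∈X̃}|F(p)|²`, while `‖·‖²_X` on unit plaquettes is a plain
sum ((547)).  Multiplying (543) through by `L^{3k} = n³` gives exactly the index-coordinate form proved here
(`n^{|ι|}·Σ_y` on the left, a plain sum over fine plaquettes on the right); at scale `j` of LEMMA 30 the same factor is
`η_j³∕η_k³ = L^{3j} = n_j³` (`η_j = L^{−(k−j)}` the spacing of `A_j`'s lattice), so (551) is `lemma29_sharp` at `n = n_j`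
verbatim and the rescaling by `L^{k−j}` of the printed proof is invisible in index coordinates.  The paper's `O(1)`
absorbs (i) the number of plaquette orientations (here: one orientation at a time, constant `1`; summing the `|ι|(|ι|−1)∕2`
orientations is termwise) and (ii) the slack between `reach Y` and `X̃` (here: an inclusion, `reach_subset_enlarge`).

**Not here.** The fields `A_{k,Ω} = H_{k,Ω}A_{k,Ω}`, the averaging operators `Q_{k,Ω}`, `Q^{(2)}_{k,Ω}` of [31] and the
identity (548) itself (it enters `eq549`/`lemma30` as the hypothesis `G = Q^{(2)}F` on `Y`); the torus (everything is
local to unit cubes; no periodic identification is made, as in `QED3BlockingGeometry.lean`); Appendix C LEMMA 28 and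
the rest of Appendix D's use in §3.  No `d = 4` statement; nothing about Bałaban's papers.
-/

noncomputable section

namespace Literature.MathematicalPhysics.QuantumFieldTheory.Dimock2011to13

namespace QED3PlaquetteAveraging

open Finset QED3TorusII

variable {ι : Type*} [Fintype ι] [DecidableEq ι]

/-! ## §1 Geometry in fine index coordinates: unit vectors, the fine plaquettes `p ∈ P_x`, counting -/

/-- `side a = 2a + 1 = L^k`: the number of fine sites per unit length (odd, paper I (21)).
[cite: Dimock2022UVStabilityQED3, App. D (544) p.75 L79–92; Dimock2002QED3TorusI, (21) p.9] -/
def side (a : ℕ) : ℕ := 2 * a + 1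

omit [Fintype ι] [DecidableEq ι] in
/-- `side a` as an integer is the `2a + 1` of `QED3TorusII.cube`. [cite: Dimock2002QED3TorusI, (21) p.9] -/
theorem natCast_side (a : ℕ) : ((side a : ℕ) : ℤ) = 2 * a + 1 := by
  simp [side]

omit [Fintype ι] [DecidableEq ι] in
/-- `side a` as a real number. [cite: Dimock2002QED3TorusI, (21) p.9] -/
theorem cast_side (a : ℕ) : ((side a : ℕ) : ℝ) = 2 * a + 1 := by
  simp [side]

omit [Fintype ι] [DecidableEq ι] in
/-- `0 < side a`. [cite: Dimock2002QED3TorusI, (21) p.9] -/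
theorem side_pos (a : ℕ) : 0 < side a := by
  unfold side; omega

/-- the unit vector `e_μ` of the fine lattice. [cite: Dimock2022UVStabilityQED3, App. D p.75 L76–77] -/
def unitVec (μ : ι) : ι → ℤ := fun i => if i = μ then 1 else 0

omit [Fintype ι] in
/-- coordinates of `e_μ`. [cite: Dimock2022UVStabilityQED3, App. D p.75 L76–77] -/
@[simp] theorem unitVec_apply (μ i : ι) : unitVec μ i = if i = μ then 1 else 0 := rfl

/-- **`p ∈ P_x`**: the lower corners `x + s e_μ + t e_ν`, `0 ≤ s, t < n`, of the `n²` plaquettes of the fine lattice in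
the `(μ, ν)` plane tiling the unit plaquette `P_x = [x, x + e_μ, x + e_μ + e_ν, x + e_ν]` (`e_μ` of unit length = `n` fine
steps). [cite: Dimock2022UVStabilityQED3, App. D (544) p.75 L76–92; (474) p.64 L81–89 («p_x is p translated so a fixed corner is x»)] -/
def tile (n : ℕ) (μ ν : ι) (x : ι → ℤ) : Finset (ι → ℤ) :=
  (range n ×ˢ range n).image fun st : ℕ × ℕ => x + (st.1 : ℤ) • unitVec μ + (st.2 : ℤ) • unitVec ν

/-- membership in `P_x`. [cite: Dimock2022UVStabilityQED3, App. D (544) p.75 L76–92] -/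
theorem mem_tile {n : ℕ} {μ ν : ι} {x z : ι → ℤ} :
    z ∈ tile n μ ν x ↔ ∃ s < n, ∃ t < n, z = x + (s : ℤ) • unitVec μ + (t : ℤ) • unitVec ν := by
  simp only [tile, mem_image, mem_product, mem_range, Prod.exists]
  constructor
  · rintro ⟨s, t, ⟨hs, ht⟩, h⟩
    exact ⟨s, hs, t, ht, h.symm⟩
  · rintro ⟨s, hs, t, ht, h⟩
    exact ⟨s, t, ⟨hs, ht⟩, h.symm⟩

/-- `#P_x ≤ n²` (`L^{2k}` fine plaquettes in a unit plaquette, (544): `∫_{p∈P_x} = L^{−2k}Σ_{p∈P_x}`).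
[cite: Dimock2022UVStabilityQED3, App. D (544) p.75 L79–92] -/
theorem card_tile_le (n : ℕ) (μ ν : ι) (x : ι → ℤ) : #(tile n μ ν x) ≤ n ^ 2 := by
  unfold tile
  refine card_image_le.trans ?_
  rw [card_product, card_range, sq]

/-- `#P_x = n²` for a genuine plaquette orientation `μ ≠ ν`. [cite: Dimock2022UVStabilityQED3, App. D (544) p.75 L79–92] -/
theorem card_tile_eq {μ ν : ι} (hμν : μ ≠ ν) (n : ℕ) (x : ι → ℤ) : #(tile n μ ν x) = n ^ 2 := by
  unfold tile
  rw [card_image_of_injective, card_product, card_range, sq]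
  rintro ⟨s, t⟩ ⟨s', t'⟩ h
  have hμ := congr_fun h μ
  have hν := congr_fun h ν
  have hs : (s : ℤ) = s' := by simpa [hμν, Ne.symm hμν] using hμ
  have ht : (t : ℤ) = t' := by simpa [hμν, Ne.symm hμν] using hν
  exact Prod.ext (by exact_mod_cast hs) (by exact_mod_cast ht)

/-- **`#{x ∈ B : P_x ∋ p} ≤ n²`** for every fine plaquette `p` and every set `B` of fine points — the count behind
«`∫_{x∈X̃ : P_x∋p} |F(p)|² ≤ O(1)‖F‖²`» in (547) (`x = p − s e_μ − t e_ν`, `0 ≤ s, t < n`).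
[cite: Dimock2022UVStabilityQED3, App. D (547) p.76 L14–21] -/
theorem card_filter_mem_tile_le (n : ℕ) (μ ν : ι) (B : Finset (ι → ℤ)) (z : ι → ℤ) :
    #(B.filter fun x => z ∈ tile n μ ν x) ≤ n ^ 2 := by
  calc #(B.filter fun x => z ∈ tile n μ ν x)
      ≤ #((range n ×ˢ range n).image
          fun st : ℕ × ℕ => z - (st.1 : ℤ) • unitVec μ - (st.2 : ℤ) • unitVec ν) := by
        refine card_le_card fun x hx => ?_
        rw [mem_filter] at hx
        obtain ⟨s, hs, t, ht, hz⟩ := mem_tile.1 hx.2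
        rw [mem_image]
        refine ⟨(s, t), mem_product.2 ⟨mem_range.2 hs, mem_range.2 ht⟩, ?_⟩
        show z - (s : ℤ) • unitVec μ - (t : ℤ) • unitVec ν = x
        rw [hz]; abel
    _ ≤ #(range n ×ˢ range n) := card_image_le
    _ = n ^ 2 := by rw [card_product, card_range, sq]

/-- `#B(y) = n^{|ι|}` (`L^{3k}` fine sites in a unit cube, (544): `∫_{|x−y|≤½} = L^{−3k}Σ_x`).
[cite: Dimock2022UVStabilityQED3, App. D (544) p.75 L79–92; Dimock2002QED3TorusI, (21) p.9] -/
theorem card_cube (a : ℕ) (c : ι → ℤ) : #(cube a c) = side a ^ Fintype.card ι := by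
  have h : ∀ μ ∈ (univ : Finset ι), #(Icc (c μ - a) (c μ + a)) = side a := by
    intro μ _
    rw [Int.card_Icc]
    have : c μ + a + 1 - (c μ - a) = ((side a : ℕ) : ℤ) := by rw [natCast_side]; ring
    rw [this, Int.toNat_natCast]
  unfold cube
  rw [Fintype.card_piFinset, prod_congr rfl h, prod_const, card_univ]

/-! ## §2 The operator `Q^{(2)}` (544) and the Schwarz steps (545)–(546) -/

section Operator

variable {E : Type*} [SeminormedAddCommGroup E] [NormedSpace ℝ E]

/-- **(544) `(Q^{(2)}_k F)(P_y) = ∫_{|x−y|≤½} L^{−2k} Σ_{p∈P_x} F(p)`**, one orientation `(μ, ν)`, in fine index coordinates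
(`n = side a = L^k`, `∫_{|x−y|≤½} = n^{−|ι|}Σ_{x ∈ B(y)}`, `B(y) = cube a (n•y)`): the average of `F` over the fine points `x`
of the unit cube at `y` and the fine plaquettes `p ∈ P_x`.
[cite: Dimock2022UVStabilityQED3, App. D (544) p.75 L76–92; (474) p.64 L81–89] -/
def plaqAvg (a : ℕ) (μ ν : ι) (F : (ι → ℤ) → E) (y : ι → ℤ) : E :=
  (((side a : ℝ) ^ Fintype.card ι * (side a : ℝ) ^ 2)⁻¹) •
    ∑ x ∈ cube a ((2 * a + 1 : ℤ) • y), ∑ z ∈ tile (side a) μ ν x, F z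

/-- unfolding `plaqAvg`. [cite: Dimock2022UVStabilityQED3, App. D (544) p.75 L76–92] -/
theorem plaqAvg_def (a : ℕ) (μ ν : ι) (F : (ι → ℤ) → E) (y : ι → ℤ) :
    plaqAvg a μ ν F y = (((side a : ℝ) ^ Fintype.card ι * (side a : ℝ) ^ 2)⁻¹) •
      ∑ x ∈ cube a ((2 * a + 1 : ℤ) • y), ∑ z ∈ tile (side a) μ ν x, F z := rfl

/-- `Q^{(2)}` is an average: `Q^{(2)}c = c` (`μ ≠ ν`). [cite: Dimock2022UVStabilityQED3, App. D (544) p.75 L76–92] -/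
theorem plaqAvg_const {μ ν : ι} (hμν : μ ≠ ν) (a : ℕ) (v : E) (y : ι → ℤ) :
    plaqAvg a μ ν (fun _ => v) y = v := by
  simp only [plaqAvg_def]
  have h1 : ∀ x ∈ cube a ((2 * a + 1 : ℤ) • y),
      ∑ _z ∈ tile (side a) μ ν x, v = ((side a ^ 2 : ℕ) : ℝ) • v := by
    intro x _
    rw [sum_const, card_tile_eq hμν, Nat.cast_smul_eq_nsmul]
  rw [sum_congr rfl h1, sum_const, card_cube, ← Nat.cast_smul_eq_nsmul ℝ, smul_smul, smul_smul]
  have hpos : (0 : ℝ) < (side a : ℝ) ^ Fintype.card ι * (side a : ℝ) ^ 2 := by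
    have := side_pos a; positivity
  have : ((side a : ℝ) ^ Fintype.card ι * (side a : ℝ) ^ 2)⁻¹ *
      ((side a ^ Fintype.card ι : ℕ) : ℝ) * ((side a ^ 2 : ℕ) : ℝ) = 1 := by
    push_cast
    rw [mul_assoc]
    exact inv_mul_cancel₀ hpos.ne'
  rw [this, one_smul]

omit [NormedSpace ℝ E] in
/-- **(545)** *"By the Schwarz inequality in the `p` integral `|∫_{p∈P_x} F(p)|² ≤ ∫_{p∈P_x} |F(p)|²`"* — with
`∫_{p∈P_x} = n^{−2}Σ_{p∈P_x}` this is `‖Σ_{p∈P_x} F(p)‖² ≤ n² Σ_{p∈P_x} ‖F(p)‖²` (`#P_x ≤ n²`).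
[cite: Dimock2022UVStabilityQED3, App. D (545) p.75 L93–107] -/
theorem eq545 (n : ℕ) (μ ν : ι) (F : (ι → ℤ) → E) (x : ι → ℤ) :
    ‖∑ z ∈ tile n μ ν x, F z‖ ^ 2 ≤ (n : ℝ) ^ 2 * ∑ z ∈ tile n μ ν x, ‖F z‖ ^ 2 := by
  have hS2 : 0 ≤ ∑ z ∈ tile n μ ν x, ‖F z‖ ^ 2 := sum_nonneg fun z _ => by positivity
  have hcard : (#(tile n μ ν x) : ℝ) ≤ (n : ℝ) ^ 2 := by exact_mod_cast card_tile_le n μ ν x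
  calc ‖∑ z ∈ tile n μ ν x, F z‖ ^ 2 ≤ (∑ z ∈ tile n μ ν x, ‖F z‖) ^ 2 :=
        pow_le_pow_left₀ (norm_nonneg _) (norm_sum_le _ _) 2
    _ ≤ #(tile n μ ν x) * ∑ z ∈ tile n μ ν x, ‖F z‖ ^ 2 := sq_sum_le_card_mul_sum_sq
    _ ≤ (n : ℝ) ^ 2 * ∑ z ∈ tile n μ ν x, ‖F z‖ ^ 2 := mul_le_mul_of_nonneg_right hcard hS2

/-- **(545)–(546)** `|(Q^{(2)}_k F)(P_y)|² ≤ ∫_{|x−y|≤½} ∫_{p∈P_x} |F(p)|²`: *"By the Schwarz inequality in the `p` integral …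
and then by the Schwarz inequality in the `x` integral"* — here in one step on the double sum, with
`#{(x, p)} ≤ n^{|ι|}·n²`. [cite: Dimock2022UVStabilityQED3, App. D (545)–(546) p.75 L93–116] -/
theorem norm_sq_plaqAvg_le (a : ℕ) (μ ν : ι) (F : (ι → ℤ) → E) (y : ι → ℤ) :
    ‖plaqAvg a μ ν F y‖ ^ 2 ≤ ((side a : ℝ) ^ Fintype.card ι * (side a : ℝ) ^ 2)⁻¹ *
      ∑ x ∈ cube a ((2 * a + 1 : ℤ) • y), ∑ z ∈ tile (side a) μ ν x, ‖F z‖ ^ 2 := by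
  set c : ℝ := (side a : ℝ) ^ Fintype.card ι * (side a : ℝ) ^ 2 with hc
  set B : Finset (ι → ℤ) := cube a ((2 * a + 1 : ℤ) • y) with hB
  set T : Finset (Σ _ : ι → ℤ, ι → ℤ) := B.sigma fun x => tile (side a) μ ν x with hT
  have hcpos : 0 < c := by have := side_pos a; positivity
  have hcardT : (#T : ℝ) ≤ c := by
    have h1 : #T ≤ side a ^ Fintype.card ι * side a ^ 2 := by
      rw [hT, card_sigma, ← card_cube a ((2 * a + 1 : ℤ) • y)]
      calc ∑ x ∈ B, #(tile (side a) μ ν x) ≤ ∑ x ∈ B, side a ^ 2 :=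
            sum_le_sum fun x _ => card_tile_le _ _ _ _
        _ = #B * side a ^ 2 := by rw [sum_const, smul_eq_mul]
    have h2 : ((#T : ℕ) : ℝ) ≤ ((side a ^ Fintype.card ι * side a ^ 2 : ℕ) : ℝ) := by exact_mod_cast h1
    simpa [hc] using h2
  have hsum : ∑ x ∈ B, ∑ z ∈ tile (side a) μ ν x, ‖F z‖ = ∑ p ∈ T, ‖F p.2‖ := by
    rw [hT, sum_sigma]
  have hsum2 : ∑ x ∈ B, ∑ z ∈ tile (side a) μ ν x, ‖F z‖ ^ 2 = ∑ p ∈ T, ‖F p.2‖ ^ 2 := by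
    rw [hT, sum_sigma]
  have hnorm : ‖plaqAvg a μ ν F y‖ ≤ c⁻¹ * ∑ p ∈ T, ‖F p.2‖ := by
    rw [plaqAvg_def, norm_smul, Real.norm_of_nonneg (inv_nonneg.2 hcpos.le), ← hsum]
    refine mul_le_mul_of_nonneg_left ?_ (inv_nonneg.2 hcpos.le)
    exact (norm_sum_le _ _).trans (sum_le_sum fun x _ => norm_sum_le _ _)
  have hS2 : 0 ≤ ∑ p ∈ T, ‖F p.2‖ ^ 2 := sum_nonneg fun p _ => by positivity
  rw [hsum2]
  calc ‖plaqAvg a μ ν F y‖ ^ 2 ≤ (c⁻¹ * ∑ p ∈ T, ‖F p.2‖) ^ 2 :=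
        pow_le_pow_left₀ (norm_nonneg _) hnorm 2
    _ = c⁻¹ ^ 2 * (∑ p ∈ T, ‖F p.2‖) ^ 2 := by ring
    _ ≤ c⁻¹ ^ 2 * (#T * ∑ p ∈ T, ‖F p.2‖ ^ 2) :=
        mul_le_mul_of_nonneg_left sq_sum_le_card_mul_sum_sq (by positivity)
    _ ≤ c⁻¹ ^ 2 * (c * ∑ p ∈ T, ‖F p.2‖ ^ 2) :=
        mul_le_mul_of_nonneg_left (mul_le_mul_of_nonneg_right hcardT hS2) (by positivity)
    _ = c⁻¹ * ∑ p ∈ T, ‖F p.2‖ ^ 2 := by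
        field_simp

/-! ## §3 (547): summing over `y`, exchanging the `x`- and `p`-sums — LEMMA 29 in sharp form -/

/-- **The exchange of sums in (547)**: `∫_{x∈X̃}∫_{p∈P_x}|F(p)|² = ∫_{p}∫_{x : P_x ∋ p}|F(p)|² ≤ O(1)‖F‖²`, i.e.
`Σ_{x∈B} Σ_{p∈P_x} g(p) ≤ n² Σ_{p ∈ ⋃_{x∈B}P_x} g(p)` for `g ≥ 0` (each `p` is counted `#{x : P_x ∋ p} ≤ n²` times).
[cite: Dimock2022UVStabilityQED3, App. D (547) p.76 L1–21] -/
theorem sum_sum_tile_le (n : ℕ) (μ ν : ι) (B : Finset (ι → ℤ)) (g : (ι → ℤ) → ℝ) (hg : ∀ z, 0 ≤ g z) :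
    ∑ x ∈ B, ∑ z ∈ tile n μ ν x, g z ≤ (n : ℝ) ^ 2 * ∑ z ∈ B.biUnion (tile n μ ν), g z := by
  rw [sum_comm' (t' := B.biUnion (tile n μ ν)) (s' := fun z => B.filter fun x => z ∈ tile n μ ν x)]
  · rw [mul_sum]
    refine sum_le_sum fun z _ => ?_
    rw [sum_const, nsmul_eq_mul]
    refine mul_le_mul_of_nonneg_right ?_ (hg z)
    exact_mod_cast card_filter_mem_tile_le n μ ν B z
  · intro x z
    simp only [mem_filter, mem_biUnion]
    constructor
    · rintro ⟨hx, hz⟩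
      exact ⟨⟨hx, hz⟩, x, hx, hz⟩
    · rintro ⟨⟨hx, hz⟩, _⟩
      exact ⟨hx, hz⟩

/-- **`reach a μ ν Y`**: the fine plaquettes `p ∈ P_x`, `x ∈ B(y)`, `y ∈ Y` — those whose values enter `(Q^{(2)}F)(P_y)` for
some `y ∈ Y`. [cite: Dimock2022UVStabilityQED3, App. D (544), (547) p.75 L79 – p.76 L21] -/
def reach (a : ℕ) (μ ν : ι) (Y : Finset (ι → ℤ)) : Finset (ι → ℤ) :=
  (blockUp a Y).biUnion (tile (side a) μ ν)

/-- membership in `reach`. [cite: Dimock2022UVStabilityQED3, App. D (544), (547) p.75 L79 – p.76 L21] -/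
theorem mem_reach {a : ℕ} {μ ν : ι} {Y : Finset (ι → ℤ)} {z : ι → ℤ} :
    z ∈ reach a μ ν Y ↔ ∃ y ∈ Y, ∃ x ∈ cube a ((2 * a + 1 : ℤ) • y), z ∈ tile (side a) μ ν x := by
  simp only [reach, mem_biUnion, blockUp]
  constructor
  · rintro ⟨x, ⟨y, hy, hx⟩, hz⟩
    exact ⟨y, hy, x, hx, hz⟩
  · rintro ⟨y, hy, x, hx, hz⟩
    exact ⟨x, ⟨y, hy, hx⟩, hz⟩

/-- the unit cubes centred on distinct points of the coarse lattice are disjoint (they partition the fine lattice).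
[cite: Dimock2002QED3TorusI, (21) p.9 L38–42 («so the B(y) form a partition»)] -/
theorem pairwiseDisjoint_cube (a : ℕ) (Y : Finset (ι → ℤ)) :
    (Y : Set (ι → ℤ)).PairwiseDisjoint fun y => cube a ((2 * a + 1 : ℤ) • y) := by
  intro y _ y' _ hne
  refine disjoint_left.2 fun x hx hx' => hne ?_
  exact (mem_cube_smul_iff.1 hx).symm.trans (mem_cube_smul_iff.1 hx')

/-- **LEMMA 29, sharp form — (547) with `O(1) = 1`**: for every finite set `Y` of unit plaquettes (one orientation),
`n^{|ι|} Σ_{y∈Y} ‖(Q^{(2)}F)(P_y)‖² ≤ Σ_{p ∈ reach Y} ‖F(p)‖²`; in Dimock's volume-weighted norms (`∫ = L^{−3k}Σ` on the fine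
lattice) this reads `‖Q^{(2)}_k F‖²_Y ≤ ‖F‖²_{reach Y}`.  Proof as printed: (546) for each `y`, the cubes `B(y)` are disjoint,
then the exchange `sum_sum_tile_le`. [cite: Dimock2022UVStabilityQED3, App. D Lemma 29 (543) p.75 L70–75, proof (544)–(547) p.75 L76 – p.76 L22] -/
theorem lemma29_sharp (a : ℕ) (μ ν : ι) (F : (ι → ℤ) → E) (Y : Finset (ι → ℤ)) :
    (side a : ℝ) ^ Fintype.card ι * ∑ y ∈ Y, ‖plaqAvg a μ ν F y‖ ^ 2 ≤ ∑ z ∈ reach a μ ν Y, ‖F z‖ ^ 2 := by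
  have hn : (0 : ℝ) < (side a : ℝ) := by exact_mod_cast side_pos a
  set c : ℝ := (side a : ℝ) ^ Fintype.card ι * (side a : ℝ) ^ 2 with hc
  have hcpos : 0 < c := by positivity
  -- (546) summed over `y`, the cubes being disjoint
  have h1 : ∑ y ∈ Y, ‖plaqAvg a μ ν F y‖ ^ 2 ≤
      c⁻¹ * ∑ x ∈ blockUp a Y, ∑ z ∈ tile (side a) μ ν x, ‖F z‖ ^ 2 := by
    calc ∑ y ∈ Y, ‖plaqAvg a μ ν F y‖ ^ 2
        ≤ ∑ y ∈ Y, c⁻¹ * ∑ x ∈ cube a ((2 * a + 1 : ℤ) • y), ∑ z ∈ tile (side a) μ ν x, ‖F z‖ ^ 2 :=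
          sum_le_sum fun y _ => norm_sq_plaqAvg_le a μ ν F y
      _ = c⁻¹ * ∑ x ∈ blockUp a Y, ∑ z ∈ tile (side a) μ ν x, ‖F z‖ ^ 2 := by
          rw [← mul_sum, blockUp, sum_biUnion (pairwiseDisjoint_cube a Y)]
  -- the exchange of sums (547)
  have h2 := sum_sum_tile_le (side a) μ ν (blockUp a Y) (fun z => ‖F z‖ ^ 2) fun z => by positivity
  have h3 : ∑ y ∈ Y, ‖plaqAvg a μ ν F y‖ ^ 2 ≤
      c⁻¹ * ((side a : ℝ) ^ 2 * ∑ z ∈ reach a μ ν Y, ‖F z‖ ^ 2) :=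
    h1.trans (mul_le_mul_of_nonneg_left h2 (inv_nonneg.2 hcpos.le))
  calc (side a : ℝ) ^ Fintype.card ι * ∑ y ∈ Y, ‖plaqAvg a μ ν F y‖ ^ 2
      ≤ (side a : ℝ) ^ Fintype.card ι * (c⁻¹ * ((side a : ℝ) ^ 2 * ∑ z ∈ reach a μ ν Y, ‖F z‖ ^ 2)) :=
        mul_le_mul_of_nonneg_left h3 (by positivity)
    _ = ∑ z ∈ reach a μ ν Y, ‖F z‖ ^ 2 := by
        rw [hc]
        field_simp

/-- **all orientations at once**: the plaquette norms of the paper sum over every orientation `(μ, ν)`; since `Q^{(2)}`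
acts orientation by orientation, the bound of `lemma29_sharp` sums termwise over any finite family of orientations `o`
(with its own datum `F_o`, `Y_o`). [cite: Dimock2022UVStabilityQED3, App. D Lemma 29 (543), (547) p.75 L70 – p.76 L22] -/
theorem lemma29_sharp_sum {O : Type*} (s : Finset O) (μ ν : O → ι) (a : ℕ) (F : O → (ι → ℤ) → E)
    (Y : O → Finset (ι → ℤ)) :
    ∑ o ∈ s, (side a : ℝ) ^ Fintype.card ι * ∑ y ∈ Y o, ‖plaqAvg a (μ o) (ν o) (F o) y‖ ^ 2 ≤
      ∑ o ∈ s, ∑ z ∈ reach a (μ o) (ν o) (Y o), ‖F o z‖ ^ 2 :=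
  sum_le_sum fun o _ => lemma29_sharp a (μ o) (ν o) (F o) (Y o)

/-! ## §4 «`P_y ∩ X ≠ ∅`», the enlargement `X̃`, and LEMMA 29 as printed -/

/-- the four corners `y, y + e_μ, y + e_ν, y + e_μ + e_ν` of the unit plaquette `P_y` (as points of the coarse lattice).
[cite: Dimock2022UVStabilityQED3, App. D p.75 L76–77 («P_x = [x, x+e_μ, x+e_μ+e_ν, x+e_ν]»)] -/
def corners (μ ν : ι) (y : ι → ℤ) : Finset (ι → ℤ) :=
  {y, y + unitVec μ, y + unitVec ν, y + unitVec μ + unitVec ν}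

/-- **«`P_y ∩ X ≠ ∅`»** for `X = blockUp a S` the union of the CLOSED unit cubes centred on the points of `S`: the closed unit
square `P_y` meets the closed unit cube centred at `s` iff `s` is one of the four corners of `P_y` (coordinatewise:
`|p_i − s_i| ≤ ½` with `p_i ∈ [y_i, y_i + 1]` for `i ∈ {μ, ν}`, `p_i = y_i` otherwise, and `s_i ∈ ℤ`).
[cite: Dimock2022UVStabilityQED3, App. D (547) p.76 L2–8 («Σ_{y : P_y ∩ X ≠ ∅}»)] -/
def Meets (μ ν : ι) (S : Finset (ι → ℤ)) (y : ι → ℤ) : Prop :=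
  ∃ s ∈ S, s ∈ corners μ ν y

/-- a corner `s` of `P_y` has `y_i ≤ s_i ≤ y_i + 1` in every coordinate (`μ ≠ ν`).
[cite: Dimock2022UVStabilityQED3, App. D p.75 L76–77] -/
theorem corner_bounds {μ ν : ι} (hμν : μ ≠ ν) {y s : ι → ℤ} (hs : s ∈ corners μ ν y) (i : ι) :
    y i ≤ s i ∧ s i ≤ y i + 1 := by
  simp only [corners, mem_insert, mem_singleton] at hs
  rcases hs with rfl | rfl | rfl | rfl
  · exact ⟨le_rfl, by omega⟩
  · simp only [Pi.add_apply, unitVec_apply]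
    split_ifs <;> omega
  · simp only [Pi.add_apply, unitVec_apply]
    split_ifs <;> omega
  · simp only [Pi.add_apply, unitVec_apply]
    by_cases hiμ : i = μ
    · have hiν : ¬ i = ν := fun h => hμν (hiμ.symm.trans h)
      rw [if_pos hiμ, if_neg hiν]; omega
    · rw [if_neg hiμ]
      split_ifs <;> omega

omit [Fintype ι] [DecidableEq ι] in
/-- locating the centre of a fine point: `n·m ≤ z_i + a < n·m + 2n` puts `ν(z)_i ∈ {m, m+1}` (`n = 2a+1`).
[cite: Dimock2004QED3TorusII, §2.1 (87)–(88) p.16 L8–25] -/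
theorem centre_apply_mem_pair {a : ℕ} {z : ι → ℤ} {i : ι} {m : ℤ}
    (h1 : (2 * a + 1 : ℤ) * m ≤ z i + a) (h2 : z i + a < (2 * a + 1 : ℤ) * m + 2 * (2 * a + 1)) :
    m ≤ centre a z i ∧ centre a z i ≤ m + 1 := by
  have hL : (0 : ℤ) < 2 * a + 1 := by positivity
  constructor
  · show m ≤ (z i + a) / (2 * a + 1 : ℤ)
    rw [Int.le_ediv_iff_mul_le hL, mul_comm]
    exact h1
  · show (z i + a) / (2 * a + 1 : ℤ) ≤ m + 1
    rw [← Int.lt_add_one_iff, Int.ediv_lt_iff_lt_mul hL]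
    calc z i + a < (2 * a + 1 : ℤ) * m + 2 * (2 * a + 1) := h2
      _ = (m + 1 + 1) * (2 * a + 1 : ℤ) := by ring

/-- a fine plaquette `p ∈ P_x` with `x` in the unit cube at `y` has its centre among the corners' range:
`y_i ≤ ν(p)_i ≤ y_i + 1` for every `i` (`μ ≠ ν`). [cite: Dimock2022UVStabilityQED3, App. D (547) p.76 L9–21] -/
theorem centre_bounds_of_mem_tile {μ ν : ι} (hμν : μ ≠ ν) {a : ℕ} {x y z : ι → ℤ}
    (hx : x ∈ cube a ((2 * a + 1 : ℤ) • y)) (hz : z ∈ tile (side a) μ ν x) (i : ι) :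
    y i ≤ centre a z i ∧ centre a z i ≤ y i + 1 := by
  rw [mem_cube] at hx
  obtain ⟨hlo, hhi⟩ := hx i
  simp only [Pi.smul_apply, smul_eq_mul] at hlo hhi
  obtain ⟨s, hs, t, ht, rfl⟩ := mem_tile.1 hz
  simp only [side] at hs ht
  obtain ⟨u, hu0, hu1, hzu⟩ : ∃ u : ℤ, 0 ≤ u ∧ u ≤ 2 * a ∧
      (x + (s : ℤ) • unitVec μ + (t : ℤ) • unitVec ν) i = x i + u := by
    by_cases hiμ : i = μ
    · have hiν : ¬ i = ν := fun h => hμν (hiμ.symm.trans h)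
      refine ⟨s, by positivity, by omega, ?_⟩
      simp [hiμ, hμν]
    · by_cases hiν : i = ν
      · refine ⟨t, by positivity, by omega, ?_⟩
        simp [hiν, Ne.symm hμν]
      · refine ⟨0, le_rfl, by positivity, ?_⟩
        simp [hiμ, hiν]
  refine centre_apply_mem_pair ?_ ?_
  · rw [hzu]
    generalize (2 * (a : ℤ) + 1) * y i = P at hlo hhi ⊢
    omega
  · rw [hzu]
    generalize (2 * (a : ℤ) + 1) * y i = P at hlo hhi ⊢
    omega

/-- **`X̃`, «an enlargement by a layer of unit cubes»**: the centres within sup-distance `1` of `S` (`cube 1 s` = the `3^{|ι|}`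
neighbours of `s`); the enlarged region of fine points is `blockUp a (enlarge S)`.
[cite: Dimock2022UVStabilityQED3, App. D Lemma 29 p.75 L70–71] -/
def enlarge (S : Finset (ι → ℤ)) : Finset (ι → ℤ) :=
  S.biUnion fun s => cube 1 s

/-- **the fine plaquettes entering `‖Q^{(2)}F‖_X` lie in `X̃`**: if every `y ∈ Y` has `P_y ∩ X ≠ ∅` (`X = blockUp a S`) then
`reach Y ⊆ blockUp a (enlarge S)` (`μ ≠ ν`). [cite: Dimock2022UVStabilityQED3, App. D (547) p.76 L9–21 («∫_{x∈X̃} ∫_{p∈P_x}»)] -/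
theorem reach_subset_enlarge {μ ν : ι} (hμν : μ ≠ ν) (a : ℕ) {S Y : Finset (ι → ℤ)}
    (hY : ∀ y ∈ Y, Meets μ ν S y) : reach a μ ν Y ⊆ blockUp a (enlarge S) := by
  intro z hz
  obtain ⟨y, hy, x, hx, hzx⟩ := mem_reach.1 hz
  obtain ⟨s, hsS, hsc⟩ := hY y hy
  rw [mem_blockUp, enlarge, mem_biUnion]
  refine ⟨s, hsS, mem_cube.2 fun i => ?_⟩
  have h1 := corner_bounds hμν hsc i
  have h2 := centre_bounds_of_mem_tile hμν hx hzx i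
  push_cast
  omega

/-- **LEMMA 29 (543) AS PRINTED, `O(1) = 1` per orientation**: `X = blockUp a S` a union of unit blocks, `X̃ = blockUp a
(enlarge S)` its enlargement by a layer of unit cubes, `Y` any finite set of unit plaquettes of orientation `(μ, ν)`, `μ ≠ ν`,
with `P_y ∩ X ≠ ∅`; then `n^{|ι|} Σ_{y∈Y} ‖(Q^{(2)}F)(P_y)‖² ≤ Σ_{p∈X̃} ‖F(p)‖²` — i.e. `‖Q^{(2)}_k F‖_X ≤ ‖F‖_{X̃}` in the
volume-weighted norms. [cite: Dimock2022UVStabilityQED3, App. D Lemma 29 (543) p.75 L70–75, proof (544)–(547) p.75 L76 – p.76 L22] -/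
theorem lemma29 {μ ν : ι} (hμν : μ ≠ ν) (a : ℕ) (F : (ι → ℤ) → E) (S Y : Finset (ι → ℤ))
    (hY : ∀ y ∈ Y, Meets μ ν S y) :
    (side a : ℝ) ^ Fintype.card ι * ∑ y ∈ Y, ‖plaqAvg a μ ν F y‖ ^ 2 ≤
      ∑ z ∈ blockUp a (enlarge S), ‖F z‖ ^ 2 :=
  (lemma29_sharp a μ ν F Y).trans
    (sum_le_sum_of_subset_of_nonneg (reach_subset_enlarge hμν a hY) fun _ _ _ => by positivity)

/-! ## §5 (548)–(549) and LEMMA 30 (550)–(551) -/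

/-- **(548) ⟹ (549)**: *"In `Ω_k` this says `dA_k = Q^{(2)}_k dA_{k,Ω}`. It follows by lemma 29 that
`‖dA_k‖²_X ≤ O(1)‖dA_{k,Ω}‖²_{X̃}`"* — any unit-plaquette function `G` agreeing with `Q^{(2)}F` on `Y` obeys the bound of
`lemma29_sharp`. [cite: Dimock2022UVStabilityQED3, App. D (548)–(549) p.76 L23–32] -/
theorem eq549 (a : ℕ) (μ ν : ι) (F : (ι → ℤ) → E) (G : (ι → ℤ) → E) (Y : Finset (ι → ℤ))
    (hG : ∀ y ∈ Y, G y = plaqAvg a μ ν F y) :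
    (side a : ℝ) ^ Fintype.card ι * ∑ y ∈ Y, ‖G y‖ ^ 2 ≤ ∑ z ∈ reach a μ ν Y, ‖F z‖ ^ 2 := by
  rw [sum_congr rfl fun y hy => by rw [hG y hy]]
  exact lemma29_sharp a μ ν F Y

/-- **LEMMA 30 (550)**: *"Let `X = ∪X_j` where `X_j ⊂ δΩ_j` … whose enlargements at that scale also satisfy `X̃_j ⊂ δΩ_j`.
Then `Σ_{j=0}^{k} ‖dA_j‖²_{X_j} ≤ O(1)‖dA_{k,Ω}‖²`"* — for a finite family of scales `j ∈ J` with sides `n_j = 2a_j + 1`,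
orientations `(μ_j, ν_j)`, unit-plaquette sets `Y_j` and fields `G_j = Q^{(2)}_{n_j}F` on `Y_j` (the proof's identity
*"`Q^{(2)}_j dA_{k,Ω,L^{k−j}} = dA_{j,L^{k−j}}` on `L^kδΩ_j`"*), whose reaches are pairwise disjoint and inside `R`:
`Σ_j n_j^{|ι|} Σ_{y∈Y_j} ‖G_j(y)‖² ≤ Σ_{p∈R} ‖F(p)‖²` — (551) at each scale is `eq549` (index coordinates make the rescaling by
`L^{k−j}` invisible: `η_j³∕η_k³ = n_j³`), then *"Summing over `j` gives the result"*.
[cite: Dimock2022UVStabilityQED3, App. D Lemma 30 (550)–(551) p.76 L33–51] -/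
theorem lemma30 {J : Type*} (s : Finset J) (a : J → ℕ) (μ ν : J → ι) (Y : J → Finset (ι → ℤ))
    (F : (ι → ℤ) → E) (G : J → (ι → ℤ) → E)
    (hG : ∀ j ∈ s, ∀ y ∈ Y j, G j y = plaqAvg (a j) (μ j) (ν j) F y)
    (R : Finset (ι → ℤ)) (hR : ∀ j ∈ s, reach (a j) (μ j) (ν j) (Y j) ⊆ R)
    (hdisj : (s : Set J).PairwiseDisjoint fun j => reach (a j) (μ j) (ν j) (Y j)) :
    ∑ j ∈ s, (side (a j) : ℝ) ^ Fintype.card ι * ∑ y ∈ Y j, ‖G j y‖ ^ 2 ≤ ∑ z ∈ R, ‖F z‖ ^ 2 := by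
  calc ∑ j ∈ s, (side (a j) : ℝ) ^ Fintype.card ι * ∑ y ∈ Y j, ‖G j y‖ ^ 2
      ≤ ∑ j ∈ s, ∑ z ∈ reach (a j) (μ j) (ν j) (Y j), ‖F z‖ ^ 2 :=
        sum_le_sum fun j hj => eq549 (a j) (μ j) (ν j) F (G j) (Y j) (hG j hj)
    _ = ∑ z ∈ s.biUnion fun j => reach (a j) (μ j) (ν j) (Y j), ‖F z‖ ^ 2 := (sum_biUnion hdisj).symm
    _ ≤ ∑ z ∈ R, ‖F z‖ ^ 2 :=
        sum_le_sum_of_subset_of_nonneg (biUnion_subset.2 hR) fun _ _ _ => by positivity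

end Operator

end QED3PlaquetteAveraging

end Literature.MathematicalPhysics.QuantumFieldTheory.Dimock2011to13
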